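import Mathlib.Analysis.PSeries
import Literature.NumberTheory.Sieve.ShiuTheoremProofs
import Literature.NumberTheory.Sieve.DivisorBound
import Summits.Parity.BatemanHorn.Theorems.SoloInformedTauRhoEulerMajorant

/-!
# The Erdős–Nair weights `h_g(c) = τ(c) ρ_g(c) ∏_{p ∣ c} (1 − ρ_g(p)/p)⁻¹` and their Rankin sums

Solo informed line (Parity / Bateman–Horn), session 138 — second file of the unconditional proof of
Erdős's bound `∑_{n ≤ x} τ(|g(n)|) ≪ x log x` (discharging the Nair–Tenenbaum hypothesis of
`SoloInformedErdosUpperBoundNT`) along Shiu's classes I–IV.  Summing the sifted-progression bound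
`SoloInformedPolySegmentSieve.polySegment_sieve_bound'` over the smooth parts `c = c_n` of `|g(n)|`
produces the multiplicative weight

  `h_g(c) = τ(c) · ρ_g(c) · ∏_{p ∣ c} (1 − ρ_g(p)/p)⁻¹`

(`ρ_g = polyRootCountMod ![g]`).  This file verifies that `h_g` lies in Shiu's class — `h_g ≥ 0`,
`h_g(1) = 1`, multiplicative, `h_g(p^l) ≤ B^l` with `B = 2W(1 + D)`, `h_g(n) ≤ A n^{1/6}` — when
`ρ_g(p) ≤ D`, `ρ_g(p) < p` and `ρ_g(p^a) ≤ W` (`W ≥ 1`) at every prime, and feeds it to the tree's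
PROVED Rankin lemma `Shiu.rankin_tail`; the prime sum in the exponent is converted into the sieve
product: `exp(∑_{p<v} h_g(p)/p) ≤ e^{K_D} ∏_{p<v} (1 − ρ_g(p)/p)⁻²` (`h_g(p)/p = 2t/(1−t)`,
`t = ρ_g(p)/p`, against `−2 log(1 − t)`, the slack `2t²/(1−t)` being summable).  Main results:

* `exists_weightSum_rankin_le` — there is `K = K(D, W)` with, for `0 ≤ η ≤ 1/6`, `v ≥ 2`, `w > 0`
  and every finite set `S` of integers `c ≥ w` all of whose prime factors are `< v`,
  `∑_{c ∈ S} h_g(c)/c ≤ K · w^{−η} · exp(2W(1+D) η v^η (log v + log 4)) · ∏_{p<v}(1 − ρ_g(p)/p)⁻²`;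
* `exists_weightSum_le` — the case `η = 0`: `∑_{c ∈ S} h_g(c)/c ≤ K ∏_{p<v}(1 − ρ_g(p)/p)⁻²`.

The weight is written out explicitly in every statement through a defining hypothesis
`hf : ∀ c, f c = …` (no definitions are introduced).  Everything is PROVED; no named facts.

References: P. Shiu, J. reine angew. Math. 313 (1980) 161–170, Lemmas 1 and 3 [Shiu1980]; M. Nair,
Acta Arith. 62 (1992) 257–269 [Nair1992]; P. Erdős, J. London Math. Soc. 27 (1952) 7–15 [Erdos1952].
-/

open Finset Real Polynomial

namespace Summit.Parity.BatemanHorn.Theorems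

open Literature.NumberTheory.Sieve

namespace ErdosDivisor

/-- `2^{ω(n)} ≤ τ(n)` for `n ≠ 0` (`τ(n) = ∏_{p ∣ n} (v_p(n) + 1)`). [folklore] -/
theorem two_pow_card_primeFactors_le_card_divisors {n : ℕ} (hn : n ≠ 0) :
    2 ^ #n.primeFactors ≤ #n.divisors := by
  rw [Nat.card_divisors hn]
  refine Finset.pow_card_le_prod _ _ _ fun p hp => ?_
  have h1 : 1 ≤ n.factorization p := by
    rw [← (Nat.prime_of_mem_primeFactors hp).dvd_iff_one_le_factorization hn]
    exact Nat.dvd_of_mem_primeFactors hp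
  omega

/-- `(1 − ρ_g(p)/p)⁻¹ ≤ 1 + ρ_g(p)` at a prime `p` with `ρ_g(p) < p`
(equivalent to `ρ_g(p)(p − 1 − ρ_g(p)) ≥ 0`). [folklore] -/
theorem inv_one_sub_rho_div_le {g : ℤ[X]} (hg : HasNoFixedPrimeDivisor ![g]) {p : ℕ}
    (hp : p.Prime) :
    (1 - (polyRootCountMod ![g] p : ℝ) / p)⁻¹ ≤ 1 + polyRootCountMod ![g] p := by
  have hp0 : (0 : ℝ) < p := by exact_mod_cast hp.pos
  have hρ : (polyRootCountMod ![g] p : ℝ) + 1 ≤ p := by exact_mod_cast Nat.succ_le_of_lt (hg p hp)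
  have hρ0 : (0 : ℝ) ≤ polyRootCountMod ![g] p := Nat.cast_nonneg _
  rw [inv_le_iff_one_le_mul₀' (one_sub_rho_div_pos hg hp)]
  have key : (1 - (polyRootCountMod ![g] p : ℝ) / p) * (1 + polyRootCountMod ![g] p) =
      1 + (polyRootCountMod ![g] p : ℝ) * ((p : ℝ) - 1 - polyRootCountMod ![g] p) / p := by
    field_simp; ring
  rw [key]
  have : 0 ≤ (polyRootCountMod ![g] p : ℝ) * ((p : ℝ) - 1 - polyRootCountMod ![g] p) / p :=
    div_nonneg (mul_nonneg hρ0 (by linarith)) hp0.le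
  linarith

/-! ### The weight `h_g` is in Shiu's class -/

/-- `h_g ≥ 0`. [folklore] -/
theorem weight_nonneg {g : ℤ[X]} (hg : HasNoFixedPrimeDivisor ![g]) {f : ℕ → ℝ}
    (hf : ∀ c : ℕ, f c = (#c.divisors : ℝ) * (polyRootCountMod ![g] c : ℝ) *
      ∏ p ∈ c.primeFactors, (1 - (polyRootCountMod ![g] p : ℝ) / p)⁻¹) (c : ℕ) : 0 ≤ f c := by
  rw [hf]
  exact mul_nonneg (mul_nonneg (Nat.cast_nonneg _) (Nat.cast_nonneg _))
    (prod_nonneg fun p hp =>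
      (inv_pos.2 (one_sub_rho_div_pos hg (Nat.prime_of_mem_primeFactors hp))).le)

/-- `h_g(1) = 1`. [folklore] -/
theorem weight_one {g : ℤ[X]} {f : ℕ → ℝ}
    (hf : ∀ c : ℕ, f c = (#c.divisors : ℝ) * (polyRootCountMod ![g] c : ℝ) *
      ∏ p ∈ c.primeFactors, (1 - (polyRootCountMod ![g] p : ℝ) / p)⁻¹) : f 1 = 1 := by
  simp [hf, polyRootCountMod_one]

/-- `h_g` is multiplicative on coprime arguments (`τ`, `ρ_g` and the Euler correction are).
[folklore] -/
theorem weight_mul {g : ℤ[X]} {f : ℕ → ℝ}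
    (hf : ∀ c : ℕ, f c = (#c.divisors : ℝ) * (polyRootCountMod ![g] c : ℝ) *
      ∏ p ∈ c.primeFactors, (1 - (polyRootCountMod ![g] p : ℝ) / p)⁻¹) {m n : ℕ}
    (hmn : m.Coprime n) : f (m * n) = f m * f n := by
  rw [hf, hf m, hf n, Nat.Coprime.card_divisors_mul hmn, polyRootCountMod_mul_of_coprime g hmn,
    Nat.Coprime.primeFactors_mul hmn, prod_union hmn.disjoint_primeFactors]
  push_cast; ring

/-- `h_g(p^l) = (l + 1) ρ_g(p^l) (1 − ρ_g(p)/p)⁻¹` for `l ≠ 0`. [folklore] -/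
theorem weight_prime_pow {g : ℤ[X]} {f : ℕ → ℝ}
    (hf : ∀ c : ℕ, f c = (#c.divisors : ℝ) * (polyRootCountMod ![g] c : ℝ) *
      ∏ p ∈ c.primeFactors, (1 - (polyRootCountMod ![g] p : ℝ) / p)⁻¹) {p : ℕ} (hp : p.Prime)
    {l : ℕ} (hl : l ≠ 0) :
    f (p ^ l) = ((l : ℝ) + 1) * (polyRootCountMod ![g] (p ^ l) : ℝ) *
      (1 - (polyRootCountMod ![g] p : ℝ) / p)⁻¹ := by
  rw [hf, Nat.primeFactors_prime_pow hl hp, prod_singleton, ← ArithmeticFunction.sigma_zero_apply,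
    ArithmeticFunction.sigma_zero_apply_prime_pow hp]
  push_cast; ring

/-- The local bound: `h_g(p^l) ≤ (l + 1) · W(1 + D)` for `l ≠ 0`. [folklore] -/
theorem weight_prime_pow_le_mul {g : ℤ[X]} (hg : HasNoFixedPrimeDivisor ![g]) {D : ℕ} {W : ℝ}
    (hD : ∀ p : ℕ, p.Prime → polyRootCountMod ![g] p ≤ D)
    (hW : ∀ p : ℕ, p.Prime → ∀ a : ℕ, (polyRootCountMod ![g] (p ^ a) : ℝ) ≤ W) {f : ℕ → ℝ}
    (hf : ∀ c : ℕ, f c = (#c.divisors : ℝ) * (polyRootCountMod ![g] c : ℝ) *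
      ∏ p ∈ c.primeFactors, (1 - (polyRootCountMod ![g] p : ℝ) / p)⁻¹) {p : ℕ} (hp : p.Prime)
    {l : ℕ} (hl : l ≠ 0) : f (p ^ l) ≤ ((l : ℝ) + 1) * (W * (1 + D)) := by
  rw [weight_prime_pow hf hp hl, mul_assoc]
  have hW0 : 0 ≤ W := (rho_nonneg g (p ^ 0)).trans (hW p hp 0)
  have hE : (1 - (polyRootCountMod ![g] p : ℝ) / p)⁻¹ ≤ 1 + D := by
    refine (inv_one_sub_rho_div_le hg hp).trans ?_
    have : (polyRootCountMod ![g] p : ℝ) ≤ D := by exact_mod_cast hD p hp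
    linarith
  refine mul_le_mul_of_nonneg_left ?_ (by positivity)
  exact mul_le_mul (hW p hp l) hE (inv_pos.2 (one_sub_rho_div_pos hg hp)).le hW0

/-- `h_g(p^l) ≤ B^l` with `B = 2W(1 + D)` (`l ≥ 1`, `W ≥ 1`; `l + 1 ≤ 2^l`). [folklore] -/
theorem weight_prime_pow_le_pow {g : ℤ[X]} (hg : HasNoFixedPrimeDivisor ![g]) {D : ℕ} {W : ℝ}
    (hD : ∀ p : ℕ, p.Prime → polyRootCountMod ![g] p ≤ D)
    (hW : ∀ p : ℕ, p.Prime → ∀ a : ℕ, (polyRootCountMod ![g] (p ^ a) : ℝ) ≤ W) (hW1 : 1 ≤ W)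
    {f : ℕ → ℝ}
    (hf : ∀ c : ℕ, f c = (#c.divisors : ℝ) * (polyRootCountMod ![g] c : ℝ) *
      ∏ p ∈ c.primeFactors, (1 - (polyRootCountMod ![g] p : ℝ) / p)⁻¹)
    (p l : ℕ) (hp : p.Prime) (hl : 1 ≤ l) : f (p ^ l) ≤ (2 * W * (1 + D)) ^ l := by
  have hK1 : 1 ≤ W * (1 + D) := by nlinarith [(Nat.cast_nonneg D : (0 : ℝ) ≤ D)]
  have hl2 : (l : ℝ) + 1 ≤ 2 ^ l := by exact_mod_cast Shiu.succ_le_two_pow l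
  calc f (p ^ l) ≤ ((l : ℝ) + 1) * (W * (1 + D)) := weight_prime_pow_le_mul hg hD hW hf hp (by omega)
    _ ≤ 2 ^ l * (W * (1 + D)) ^ l := by
        refine mul_le_mul hl2 ?_ (by positivity) (by positivity)
        exact le_self_pow₀ hK1 (by omega)
    _ = (2 * W * (1 + D)) ^ l := by rw [← mul_pow]; ring

/-- `h_g(n) ≤ τ(n) · (W(1 + D))^{ω(n)}` for `n ≠ 0` (factor by factor). [folklore] -/
theorem weight_le_card_divisors_mul_pow {g : ℤ[X]} (hg : HasNoFixedPrimeDivisor ![g]) {D : ℕ}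
    {W : ℝ} (hD : ∀ p : ℕ, p.Prime → polyRootCountMod ![g] p ≤ D)
    (hW : ∀ p : ℕ, p.Prime → ∀ a : ℕ, (polyRootCountMod ![g] (p ^ a) : ℝ) ≤ W) {f : ℕ → ℝ}
    (hf : ∀ c : ℕ, f c = (#c.divisors : ℝ) * (polyRootCountMod ![g] c : ℝ) *
      ∏ p ∈ c.primeFactors, (1 - (polyRootCountMod ![g] p : ℝ) / p)⁻¹) {n : ℕ} (hn : n ≠ 0) :
    f n ≤ (#n.divisors : ℝ) * (W * (1 + D)) ^ #n.primeFactors := by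
  have hfac := Nat.multiplicative_factorization f (fun m n hmn => weight_mul hf hmn)
    (weight_one hf) hn
  rw [hfac, Finsupp.prod, Nat.support_factorization, Nat.card_divisors hn, Nat.cast_prod,
    ← prod_const, ← prod_mul_distrib]
  refine prod_le_prod (fun p _ => weight_nonneg hg hf _) fun p hp => ?_
  have hpp : p.Prime := Nat.prime_of_mem_primeFactors hp
  have hk : n.factorization p ≠ 0 := by
    rw [← Finsupp.mem_support_iff, Nat.support_factorization]; exact hp
  have h := weight_prime_pow_le_mul hg hD hW hf hpp hk
  push_cast; exact h

/-- **`h_g(n) ≪ n^{1/6}`**: there is `A` with `h_g(n) ≤ A n^{1/6}` for all `n ≥ 1`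
(`h_g(n) ≤ τ(n) K^{ω(n)} ≤ τ(n)^{j+1}` for `K ≤ 2^j`, then the divisor bound with exponent
`1/(6(j+1))`). [folklore] -/
theorem exists_weight_le_rpow {g : ℤ[X]} (hg : HasNoFixedPrimeDivisor ![g]) {D : ℕ} {W : ℝ}
    (hD : ∀ p : ℕ, p.Prime → polyRootCountMod ![g] p ≤ D)
    (hW : ∀ p : ℕ, p.Prime → ∀ a : ℕ, (polyRootCountMod ![g] (p ^ a) : ℝ) ≤ W) {f : ℕ → ℝ}
    (hf : ∀ c : ℕ, f c = (#c.divisors : ℝ) * (polyRootCountMod ![g] c : ℝ) *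
      ∏ p ∈ c.primeFactors, (1 - (polyRootCountMod ![g] p : ℝ) / p)⁻¹) :
    ∃ A : ℝ, ∀ n : ℕ, 1 ≤ n → f n ≤ A * (n : ℝ) ^ (1 / 6 : ℝ) := by
  have hW0 : 0 ≤ W := (rho_nonneg g (2 ^ 0)).trans (hW 2 Nat.prime_two 0)
  set K : ℝ := W * (1 + D) with hK
  have hK0 : 0 ≤ K := by positivity
  set j : ℕ := ⌈K⌉₊ with hj
  have hKj : K ≤ (2 : ℝ) ^ j :=
    (Nat.le_ceil K).trans (by exact_mod_cast (Nat.lt_two_pow_self).le)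
  obtain ⟨C, hC1, hC⟩ := exists_card_divisors_le_mul_rpow (ε := 1 / (6 * ((j : ℝ) + 1))) (by positivity)
  refine ⟨C ^ (j + 1), fun n hn => ?_⟩
  have hn0 : n ≠ 0 := by omega
  have hτ := hC n hn0
  have hτ0 : (0 : ℝ) ≤ #n.divisors := Nat.cast_nonneg _
  have hKω : K ^ #n.primeFactors ≤ (#n.divisors : ℝ) ^ j := by
    calc K ^ #n.primeFactors ≤ ((2 : ℝ) ^ j) ^ #n.primeFactors := pow_le_pow_left₀ hK0 hKj _
      _ = ((2 : ℝ) ^ #n.primeFactors) ^ j := by rw [← pow_mul, ← pow_mul, mul_comm]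
      _ ≤ (#n.divisors : ℝ) ^ j := pow_le_pow_left₀ (by positivity)
          (by exact_mod_cast two_pow_card_primeFactors_le_card_divisors hn0) _
  calc f n ≤ (#n.divisors : ℝ) * K ^ #n.primeFactors :=
        weight_le_card_divisors_mul_pow hg hD hW hf hn0
    _ ≤ (#n.divisors : ℝ) * (#n.divisors : ℝ) ^ j := mul_le_mul_of_nonneg_left hKω hτ0
    _ = (#n.divisors : ℝ) ^ (j + 1) := by ring
    _ ≤ (C * (n : ℝ) ^ (1 / (6 * ((j : ℝ) + 1)))) ^ (j + 1) := pow_le_pow_left₀ hτ0 hτ _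
    _ = C ^ (j + 1) * (n : ℝ) ^ (1 / 6 : ℝ) := by
        rw [mul_pow, ← Real.rpow_mul_natCast (Nat.cast_nonneg n)]
        congr 2
        push_cast
        field_simp

/-- For `0 ≤ t < 1`: `2t/(1 − t) ≤ −2 log(1 − t) + 2 t²/(1 − t)` (from `log(1 − t) ≤ −t`).
[folklore] -/
theorem two_mul_div_one_sub_le {t : ℝ} (ht1 : t < 1) :
    2 * t / (1 - t) ≤ -2 * Real.log (1 - t) + 2 * (t ^ 2 / (1 - t)) := by
  have h1t : 0 < 1 - t := by linarith
  have hlog : Real.log (1 - t) ≤ -t := by have := Real.log_le_sub_one_of_pos h1t; linarith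
  have heq : 2 * t / (1 - t) = 2 * t + 2 * (t ^ 2 / (1 - t)) := by field_simp; ring
  rw [heq]; linarith

/-- The slack at one prime: with `t = ρ_g(p)/p`, `t²/(1 − t) ≤ 2D²/p² + [p ≤ 2D] · 2D`
(`t ≤ 1/2` for `p > 2D`; `1/(1 − t) = p/(p − ρ_g(p)) ≤ p` always). [folklore] -/
theorem sq_div_one_sub_le {g : ℤ[X]} (hg : HasNoFixedPrimeDivisor ![g]) {D : ℕ}
    (hD : ∀ p : ℕ, p.Prime → polyRootCountMod ![g] p ≤ D) {p : ℕ} (hp : p.Prime) :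
    ((polyRootCountMod ![g] p : ℝ) / p) ^ 2 / (1 - (polyRootCountMod ![g] p : ℝ) / p) ≤
      2 * (D : ℝ) ^ 2 / (p : ℝ) ^ 2 + (if p ≤ 2 * D then 2 * (D : ℝ) else 0) := by
  have hp0 : (0 : ℝ) < p := by exact_mod_cast hp.pos
  have h1t := one_sub_rho_div_pos hg hp
  have hρD : (polyRootCountMod ![g] p : ℝ) ≤ D := by exact_mod_cast hD p hp
  have hρ0 : (0 : ℝ) ≤ polyRootCountMod ![g] p := Nat.cast_nonneg _
  have hρ1 : (polyRootCountMod ![g] p : ℝ) + 1 ≤ p := by exact_mod_cast Nat.succ_le_of_lt (hg p hp)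
  set t : ℝ := (polyRootCountMod ![g] p : ℝ) / p with ht
  have ht0 : 0 ≤ t := by positivity
  have htlt : t < 1 := by linarith
  have hsq : 0 ≤ 2 * (D : ℝ) ^ 2 / (p : ℝ) ^ 2 := by positivity
  by_cases h2D : p ≤ 2 * D
  · rw [if_pos h2D]
    have hp2D : (p : ℝ) ≤ 2 * D := by exact_mod_cast h2D
    have h1 : t ^ 2 / (1 - t) ≤ 1 / (1 - t) := div_le_div_of_nonneg_right (by nlinarith) h1t.le
    have h2 : 1 / (1 - t) ≤ p := by
      rw [div_le_iff₀ h1t]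
      have : (p : ℝ) * (1 - t) = p - polyRootCountMod ![g] p := by rw [ht]; field_simp
      rw [this]; linarith
    linarith
  · rw [if_neg h2D, add_zero]
    have hp2D : 2 * (D : ℝ) < p := by exact_mod_cast (not_le.1 h2D)
    have ht12 : t ≤ 1 / 2 := by
      rw [ht, div_le_iff₀ hp0]; linarith
    have h1 : t ^ 2 / (1 - t) ≤ 2 * t ^ 2 := by
      rw [div_le_iff₀ h1t]; nlinarith [sq_nonneg t]
    have h2 : t ^ 2 ≤ (D : ℝ) ^ 2 / (p : ℝ) ^ 2 := by
      rw [ht, div_pow]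
      exact div_le_div_of_nonneg_right (pow_le_pow_left₀ hρ0 hρD 2) (by positivity)
    calc t ^ 2 / (1 - t) ≤ 2 * t ^ 2 := h1
      _ ≤ 2 * ((D : ℝ) ^ 2 / (p : ℝ) ^ 2) := by linarith
      _ = 2 * (D : ℝ) ^ 2 / (p : ℝ) ^ 2 := by ring

/-- The slack summed over any finite set of primes: `∑_{p ∈ s} t_p²/(1 − t_p) ≤ 6D² + 2D`.
[folklore] -/
theorem sum_sq_div_one_sub_le {g : ℤ[X]} (hg : HasNoFixedPrimeDivisor ![g]) {D : ℕ}
    (hD : ∀ p : ℕ, p.Prime → polyRootCountMod ![g] p ≤ D) {s : Finset ℕ}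
    (hs : ∀ p ∈ s, p.Prime) :
    ∑ p ∈ s, ((polyRootCountMod ![g] p : ℝ) / p) ^ 2 / (1 - (polyRootCountMod ![g] p : ℝ) / p) ≤
      2 * (D : ℝ) ^ 2 + 2 * D * (2 * D + 1) := by
  refine (sum_le_sum fun p hp => sq_div_one_sub_le hg hD (hs p hp)).trans ?_
  rw [sum_add_distrib]
  refine add_le_add ?_ ?_
  · set M := s.sup id with hM
    have hsub : s ⊆ Ioo 1 (M + 1) := fun p hp =>
      mem_Ioo.2 ⟨(hs p hp).one_lt, Nat.lt_succ_of_le (le_sup (f := id) hp)⟩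
    calc ∑ p ∈ s, 2 * (D : ℝ) ^ 2 / (p : ℝ) ^ 2
        ≤ ∑ p ∈ Ioo 1 (M + 1), 2 * (D : ℝ) ^ 2 / (p : ℝ) ^ 2 :=
          sum_le_sum_of_subset_of_nonneg hsub fun p _ _ => by positivity
      _ = 2 * (D : ℝ) ^ 2 * ∑ p ∈ Ioo 1 (M + 1), ((p : ℝ) ^ 2)⁻¹ := by
          rw [mul_sum]
          exact sum_congr rfl fun p _ => by rw [div_eq_mul_inv]
      _ ≤ 2 * (D : ℝ) ^ 2 * 1 := by
          refine mul_le_mul_of_nonneg_left ?_ (by positivity)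
          have h := sum_Ioo_inv_sq_le (α := ℝ) 1 (M + 1)
          norm_num at h; exact h
      _ = 2 * (D : ℝ) ^ 2 := mul_one _
  · rw [← sum_filter]
    calc ∑ p ∈ s.filter (fun p => p ≤ 2 * D), (2 * (D : ℝ))
        = #(s.filter (fun p => p ≤ 2 * D)) * (2 * (D : ℝ)) := by rw [sum_const, nsmul_eq_mul]
      _ ≤ ((2 * D + 1 : ℕ) : ℝ) * (2 * (D : ℝ)) := by
          refine mul_le_mul_of_nonneg_right ?_ (by positivity)
          have : #(s.filter (fun p => p ≤ 2 * D)) ≤ #(range (2 * D + 1)) :=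
            card_le_card fun p hp => mem_range.2 (Nat.lt_succ_of_le (mem_filter.1 hp).2)
          rw [card_range] at this
          exact_mod_cast this
      _ = 2 * D * (2 * D + 1) := by push_cast; ring

/-- **The prime sum against the sieve product**: for a finite set `s` of primes,
`exp(∑_{p ∈ s} h_g(p)/p) ≤ e^{2(6D² + 2D)} · (∏_{p ∈ s} (1 − ρ_g(p)/p))⁻²`
(`h_g(p)/p = 2t_p/(1 − t_p) ≤ −2 log(1 − t_p) + 2t_p²/(1 − t_p)`). [folklore] -/
theorem exp_sum_weight_div_le {g : ℤ[X]} (hg : HasNoFixedPrimeDivisor ![g]) {D : ℕ}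
    (hD : ∀ p : ℕ, p.Prime → polyRootCountMod ![g] p ≤ D) {f : ℕ → ℝ}
    (hf : ∀ c : ℕ, f c = (#c.divisors : ℝ) * (polyRootCountMod ![g] c : ℝ) *
      ∏ p ∈ c.primeFactors, (1 - (polyRootCountMod ![g] p : ℝ) / p)⁻¹) {s : Finset ℕ}
    (hs : ∀ p ∈ s, p.Prime) :
    Real.exp (∑ p ∈ s, f p / p) ≤ Real.exp (2 * (2 * (D : ℝ) ^ 2 + 2 * D * (2 * D + 1))) *
      ((∏ p ∈ s, (1 - (polyRootCountMod ![g] p : ℝ) / p)) ^ 2)⁻¹ := by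
  have hfp : ∀ p ∈ s, f p / p = 2 * ((polyRootCountMod ![g] p : ℝ) / p) /
      (1 - (polyRootCountMod ![g] p : ℝ) / p) := by
    intro p hp
    have hpp := hs p hp
    have hp0 : (p : ℝ) ≠ 0 := by exact_mod_cast hpp.ne_zero
    have h1t := (one_sub_rho_div_pos hg hpp).ne'
    rw [hf, hpp.primeFactors, prod_singleton, Nat.Prime.divisors hpp, card_pair hpp.one_lt.ne]
    have hsub : (1 - (polyRootCountMod ![g] p : ℝ) / p) = ((p : ℝ) - polyRootCountMod ![g] p) / p := by
      field_simp
    rw [hsub] at h1t ⊢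
    have hnum : (p : ℝ) - polyRootCountMod ![g] p ≠ 0 := fun h => h1t (by rw [h, zero_div])
    field_simp
    push_cast; ring
  set L := ∑ p ∈ s, Real.log (1 - (polyRootCountMod ![g] p : ℝ) / p) with hL
  have hle : ∑ p ∈ s, f p / p ≤ -2 * L + 2 * (2 * (D : ℝ) ^ 2 + 2 * D * (2 * D + 1)) := by
    calc ∑ p ∈ s, f p / p
        = ∑ p ∈ s, 2 * ((polyRootCountMod ![g] p : ℝ) / p) /
            (1 - (polyRootCountMod ![g] p : ℝ) / p) := sum_congr rfl hfp
      _ ≤ ∑ p ∈ s, (-2 * Real.log (1 - (polyRootCountMod ![g] p : ℝ) / p) +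
            2 * (((polyRootCountMod ![g] p : ℝ) / p) ^ 2 /
              (1 - (polyRootCountMod ![g] p : ℝ) / p))) :=
          sum_le_sum fun p hp => two_mul_div_one_sub_le (by
            have := one_sub_rho_div_pos hg (hs p hp); linarith)
      _ = -2 * L + 2 * ∑ p ∈ s, ((polyRootCountMod ![g] p : ℝ) / p) ^ 2 /
            (1 - (polyRootCountMod ![g] p : ℝ) / p) := by
          rw [sum_add_distrib, ← mul_sum, ← mul_sum]
      _ ≤ _ := by
          have := sum_sq_div_one_sub_le hg hD hs
          linarith
  have hPpos : 0 < ∏ p ∈ s, (1 - (polyRootCountMod ![g] p : ℝ) / p) :=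
    prod_pos fun p hp => one_sub_rho_div_pos hg (hs p hp)
  have hexpL : Real.exp L = ∏ p ∈ s, (1 - (polyRootCountMod ![g] p : ℝ) / p) := by
    rw [hL, ← Real.log_prod (hf := fun p hp => (one_sub_rho_div_pos hg (hs p hp)).ne')]
    exact Real.exp_log hPpos
  calc Real.exp (∑ p ∈ s, f p / p)
      ≤ Real.exp (-2 * L + 2 * (2 * (D : ℝ) ^ 2 + 2 * D * (2 * D + 1))) := Real.exp_le_exp.2 hle
    _ = Real.exp (2 * (2 * (D : ℝ) ^ 2 + 2 * D * (2 * D + 1))) * Real.exp (-2 * L) := by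
        rw [Real.exp_add, mul_comm]
    _ = _ := by
        congr 1
        rw [show -2 * L = -(L + L) by ring, Real.exp_neg, Real.exp_add, hexpL, sq]

/-- Shiu's sifting set at modulus `1` is the set of all primes below `v`. [folklore] -/
theorem primesBelowNotDvd_one (v : ℝ) : Shiu.primesBelowNotDvd v 1 = Nat.primesBelow ⌈v⌉₊ := by
  rw [Shiu.primesBelowNotDvd]
  exact filter_true_of_mem fun p hp => (Nat.mem_primesBelow.1 hp).2.not_dvd_one

/-- **Rankin sums of the Erdős–Nair weight.**  If `ρ_g(p) ≤ D`, `ρ_g(p) < p` and `ρ_g(p^a) ≤ W`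
(`W ≥ 1`) at every prime, there is `K = K(g) > 0` such that for all `0 ≤ η ≤ 1/6`, `v ≥ 2`,
`w > 0` and every finite set `S` of integers `c ≥ w` all of whose prime factors are `< v`,
`∑_{c ∈ S} h_g(c)/c ≤ K · w^{−η} · exp(2W(1+D) · η v^η (log v + log 4)) · (∏_{p<v}(1 − ρ_g(p)/p))⁻²`
(the tree's `Shiu.rankin_tail` for `h_g`, then `exp_sum_weight_div_le`).
[cite: Shiu1980, Lemma 3]; [folklore] -/
theorem exists_weightSum_rankin_le {g : ℤ[X]} (hg : HasNoFixedPrimeDivisor ![g]) {D : ℕ} {W : ℝ}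
    (hD : ∀ p : ℕ, p.Prime → polyRootCountMod ![g] p ≤ D)
    (hW : ∀ p : ℕ, p.Prime → ∀ a : ℕ, (polyRootCountMod ![g] (p ^ a) : ℝ) ≤ W) (hW1 : 1 ≤ W) :
    ∃ K : ℝ, 0 < K ∧ ∀ (η : ℝ), 0 ≤ η → η ≤ 1 / 6 → ∀ (v w : ℝ), 2 ≤ v → 0 < w →
      ∀ (S : Finset ℕ), (∀ c ∈ S, c ≠ 0) → (∀ c ∈ S, w ≤ (c : ℝ)) →
        (∀ c ∈ S, ∀ p ∈ c.primeFactors, (p : ℝ) < v) →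
        ∑ c ∈ S, (#c.divisors : ℝ) * (polyRootCountMod ![g] c : ℝ) *
            (∏ p ∈ c.primeFactors, (1 - (polyRootCountMod ![g] p : ℝ) / p)⁻¹) / c ≤
          K * w ^ (-η) * Real.exp (2 * W * (1 + D) * η * v ^ η * (Real.log v + Real.log 4)) *
            ((∏ p ∈ Nat.primesBelow ⌈v⌉₊, (1 - (polyRootCountMod ![g] p : ℝ) / p)) ^ 2)⁻¹ := by
  set f : ℕ → ℝ := fun c => (#c.divisors : ℝ) * (polyRootCountMod ![g] c : ℝ) *
    ∏ p ∈ c.primeFactors, (1 - (polyRootCountMod ![g] p : ℝ) / p)⁻¹ with hfdef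
  have hf : ∀ c : ℕ, f c = (#c.divisors : ℝ) * (polyRootCountMod ![g] c : ℝ) *
      ∏ p ∈ c.primeFactors, (1 - (polyRootCountMod ![g] p : ℝ) / p)⁻¹ := fun c => rfl
  obtain ⟨A, hA⟩ := exists_weight_le_rpow hg hD hW hf
  set B : ℝ := 2 * W * (1 + D) with hB
  have hB1 : 1 ≤ B := by
    rw [hB]; nlinarith [(Nat.cast_nonneg D : (0 : ℝ) ≤ D)]
  set KD : ℝ := 2 * (2 * (D : ℝ) ^ 2 + 2 * D * (2 * D + 1)) with hKD
  refine ⟨Real.exp KD * Real.exp (Shiu.K₅ A B), by positivity,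
    fun η hη0 hη v w hv hw S hS0 hSw hSv => ?_⟩
  have h := Shiu.rankin_tail (weight_nonneg hg hf) (weight_one hf) (fun m n hmn => weight_mul hf hmn)
    hB1 (weight_prime_pow_le_pow hg hD hW hW1 hf) hA hη0 hη hv hw 1 hS0 hSw
    (fun c _ => Nat.coprime_one_right c) hSv
  rw [primesBelowNotDvd_one] at h
  have hexp := exp_sum_weight_div_le hg hD hf (s := Nat.primesBelow ⌈v⌉₊)
    (fun p hp => (Nat.mem_primesBelow.1 hp).2)
  calc ∑ c ∈ S, f c / c
      ≤ w ^ (-η) * Real.exp (∑ p ∈ Nat.primesBelow ⌈v⌉₊, f p / p +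
          B * η * v ^ η * (Real.log v + Real.log 4) + Shiu.K₅ A B) := h
    _ = w ^ (-η) * (Real.exp (∑ p ∈ Nat.primesBelow ⌈v⌉₊, f p / p) *
          Real.exp (B * η * v ^ η * (Real.log v + Real.log 4)) * Real.exp (Shiu.K₅ A B)) := by
        rw [Real.exp_add, Real.exp_add]
    _ ≤ w ^ (-η) * (Real.exp KD * ((∏ p ∈ Nat.primesBelow ⌈v⌉₊,
          (1 - (polyRootCountMod ![g] p : ℝ) / p)) ^ 2)⁻¹ *
          Real.exp (B * η * v ^ η * (Real.log v + Real.log 4)) * Real.exp (Shiu.K₅ A B)) := by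
        gcongr
    _ = _ := by rw [hB]; ring

/-- **Plain sums of the Erdős–Nair weight** (`η = 0`): with `K` as above, for every `v ≥ 2` and
every finite set `S` of positive integers all of whose prime factors are `< v`,
`∑_{c ∈ S} h_g(c)/c ≤ K · (∏_{p<v} (1 − ρ_g(p)/p))⁻²` — the class-I weight sum
`∑_{c ≤ z} h_g(c)/c ≪ P_g(z)⁻² ≍ log² z`. [cite: Shiu1980, Lemma 1]; [folklore] -/
theorem exists_weightSum_le {g : ℤ[X]} (hg : HasNoFixedPrimeDivisor ![g]) {D : ℕ} {W : ℝ}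
    (hD : ∀ p : ℕ, p.Prime → polyRootCountMod ![g] p ≤ D)
    (hW : ∀ p : ℕ, p.Prime → ∀ a : ℕ, (polyRootCountMod ![g] (p ^ a) : ℝ) ≤ W) (hW1 : 1 ≤ W) :
    ∃ K : ℝ, 0 < K ∧ ∀ (v : ℝ), 2 ≤ v → ∀ (S : Finset ℕ), (∀ c ∈ S, c ≠ 0) →
      (∀ c ∈ S, ∀ p ∈ c.primeFactors, (p : ℝ) < v) →
        ∑ c ∈ S, (#c.divisors : ℝ) * (polyRootCountMod ![g] c : ℝ) *
            (∏ p ∈ c.primeFactors, (1 - (polyRootCountMod ![g] p : ℝ) / p)⁻¹) / c ≤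
          K * ((∏ p ∈ Nat.primesBelow ⌈v⌉₊, (1 - (polyRootCountMod ![g] p : ℝ) / p)) ^ 2)⁻¹ := by
  obtain ⟨K, hK, h⟩ := exists_weightSum_rankin_le hg hD hW hW1
  refine ⟨K, hK, fun v hv S hS0 hSv => ?_⟩
  have h1 := h 0 le_rfl (by norm_num) v 1 hv one_pos S hS0
    (fun c hc => by exact_mod_cast Nat.one_le_iff_ne_zero.2 (hS0 c hc)) hSv
  simpa only [neg_zero, Real.rpow_zero, mul_one, mul_zero, zero_mul, Real.exp_zero] using h1

end ErdosDivisor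

end Summit.Parity.BatemanHorn.Theorems
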